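import Mathlib
import Summits.ValiantsHypothesis.ValiantsHypothesis.Theses.LiouvilleSarnak
import Summits.ValiantsHypothesis.ValiantsHypothesis.Theorems.LiouvilleSarnakDigitalBilinearLiouvilleRectanglesTools

/-!
# Route LiouvilleSarnak — crux `DigitalBilinearLiouville` (stmt-ValiantsHypothesis-14774):
# the crux in RECTANGLE-DISCREPANCY currency (no test vectors)

The crux `DigitalBilinearLiouville` bounds the OPERATOR NORM of every balanced digital cut matrix
`M_π(r, c) = λ(N_π(r, c) + 1)` (`2^n × 2^n`, entries `±1`):
`‖Σ_{r,c} u_r w_c M_π(r,c)‖² ≤ ε · 4^n · ‖u‖² ‖w‖²` for ALL complex test vectors `u, w` — its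
"why it might fail" reads: a Type-II bound for `λ` against ARBITRARY unit vectors.  This file
removes the vectors: the crux is EQUIVALENT to a statement about SETS,

  `∀ ε > 0, ∃ n₀, ∀ n ≥ n₀, ∀ π, ∀ A B ⊆ {0,1}^n:  |Σ_{r ∈ A} Σ_{c ∈ B} λ(N_π(r, c) + 1)| ≤ ε · 4^n`

— `λ` has discrepancy `o(X)` on every DIGITAL COMBINATORIAL RECTANGLE `A ×_π B ⊆ [1, X]`
(`X = 4^n`; the numbers `≤ X` whose row digits lie in `A` and whose column digits lie in `B`, for
the bit partition `π`).

* `rectangles_of_digitalBilinearLiouville`: crux ⇒ rectangles with `ε ↦ ε²` (indicator test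
  vectors; `|Σ_{A × B} λ|² ≤ ε² 4^n |A| |B|`, `|A|, |B| ≤ 2^n`).
* `digitalBilinearLiouville_of_rectangles`: rectangles at `δ = ε √ε / 1024` ⇒ crux at `ε`, by the
  delocalisation inequality of the tools file
  (`Rectangles.norm_sum_mul_mul_sq_le`: `‖Σ u_r w_c M_{rc}‖² ≤ 4 (4τ²R + 2√N/τ)² ‖u‖² ‖w‖²`
  with `R = δ 4^n`, `N = 2^n`, `τ = 8/(√ε √N)`, so that `4 (4τ²R + 2√N/τ)² = ε 4^n`).
* ★ `digitalBilinearLiouville_iff_rectangles`.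

Honest framing: an equivalent reformulation (polynomial loss in `ε`), not a weakening; it puts the
crux in the currency of sums of `λ` over structured sets, where the number theory operates
(the aligned rectangles `A = {0,1}^n`, `B` arbitrary are the `ℓ¹` statement `AlignedTypeI`-type sums;
general `A ×_π B` is the open content).  The crux `DigitalBilinearLiouville`, `LiouvilleCutRank`
(every `W`) and `AlgebraicSarnak` stay OPEN, and nothing here bears on VP versus VNP.  No
definitions (the rectangle form is written out verbatim in the theorem types).
-/

-- the directory `ValiantsHypothesis/ValiantsHypothesis` repeats the summit name (tree layout)
set_option linter.dupNamespace false

namespace Summit.ValiantsHypothesis.ValiantsHypothesis.Theorems.LiouvilleSarnakDigitalBilinearLiouville.Rectangles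

open Finset

open Summit.ValiantsHypothesis.ValiantsHypothesis.Theses.LiouvilleSarnak (DigitalBilinearLiouville)

/-! ### §3 The crux in rectangle currency -/

open ArithmeticFunction

/-- `|λ(m + 1)| ≤ 1` (as a real number; in fact `= 1`). [folklore] -/
theorem abs_liouville_succ_cast_le_one (m : ℕ) : |((liouville (m + 1) : ℤ) : ℝ)| ≤ 1 := by
  rw [liouville_apply (Nat.succ_ne_zero _)]
  push_cast
  rw [abs_pow, abs_neg, abs_one, one_pow]

/-- **Crux ⇒ rectangles** (`ε ↦ ε²`, indicator test vectors: `|Σ_{A × B} λ|² ≤ ε² 4^n |A| |B|`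
and `|A|, |B| ≤ 2^n`). [folklore] -/
theorem rectangles_of_digitalBilinearLiouville (h : DigitalBilinearLiouville) :
    ∀ ε : ℝ, 0 < ε → ∃ n₀ : ℕ, ∀ n ≥ n₀, ∀ π : Fin n ⊕ Fin n ≃ Fin (2 * n),
      ∀ A B : Finset (Fin n → Bool),
        |∑ r ∈ A, ∑ c ∈ B, ((liouville
          (Nat.ofBits (fun j : Fin (2 * n) => Sum.elim r c (π.symm j)) + 1) : ℤ) : ℝ)| ≤
          ε * 4 ^ n := by
  classical
  intro ε hε
  obtain ⟨n₀, hn₀⟩ := h (ε ^ 2) (by positivity)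
  refine ⟨n₀, fun n hn π A B => ?_⟩
  have key := hn₀ n hn π (fun r => if r ∈ A then (1 : ℂ) else 0)
    (fun c => if c ∈ B then (1 : ℂ) else 0)
  -- the bilinear form at indicator vectors is the rectangle sum
  have hsum : ∑ r : Fin n → Bool, ∑ c : Fin n → Bool, (if r ∈ A then (1 : ℂ) else 0) *
      (if c ∈ B then (1 : ℂ) else 0) *
      ((liouville (Nat.ofBits (fun j : Fin (2 * n) => Sum.elim r c (π.symm j)) + 1) : ℤ) : ℂ) =
      ((∑ r ∈ A, ∑ c ∈ B, ((liouville
        (Nat.ofBits (fun j : Fin (2 * n) => Sum.elim r c (π.symm j)) + 1) : ℤ) : ℝ) : ℝ) : ℂ) := by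
    rw [sum_indicator_mul_indicator_mul]
    push_cast
    rfl
  have hu : ∑ r : Fin n → Bool, ‖(if r ∈ A then (1 : ℂ) else 0)‖ ^ 2 = A.card := by
    simp [apply_ite (fun z : ℂ => ‖z‖ ^ 2)]
  have hw : ∑ c : Fin n → Bool, ‖(if c ∈ B then (1 : ℂ) else 0)‖ ^ 2 = B.card := by
    simp [apply_ite (fun z : ℂ => ‖z‖ ^ 2)]
  rw [hsum, hu, hw, Complex.norm_real, Real.norm_eq_abs] at key
  have hA : (A.card : ℝ) ≤ 2 ^ n := by
    have := A.card_le_univ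
    rw [Fintype.card_fun, Fintype.card_bool, Fintype.card_fin] at this
    exact_mod_cast this
  have hB : (B.card : ℝ) ≤ 2 ^ n := by
    have := B.card_le_univ
    rw [Fintype.card_fun, Fintype.card_bool, Fintype.card_fin] at this
    exact_mod_cast this
  have h4 : (2 : ℝ) ^ n * 2 ^ n = 4 ^ n := by rw [← mul_pow]; norm_num
  have hsq : |∑ r ∈ A, ∑ c ∈ B, ((liouville
      (Nat.ofBits (fun j : Fin (2 * n) => Sum.elim r c (π.symm j)) + 1) : ℤ) : ℝ)| ^ 2 ≤
      (ε * 4 ^ n) ^ 2 := by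
    calc _ ≤ ε ^ 2 * 4 ^ n * A.card * B.card := key
      _ ≤ ε ^ 2 * 4 ^ n * 2 ^ n * 2 ^ n := by gcongr
      _ = (ε * 4 ^ n) ^ 2 := by rw [mul_assoc (ε ^ 2 * 4 ^ n), h4]; ring
  exact (pow_le_pow_iff_left₀ (abs_nonneg _) (by positivity) two_ne_zero).mp hsq

/-- **Rectangles ⇒ crux** (rectangles at `δ = ε √ε / 1024` give the crux at `ε`: delocalisation
with `R = δ 4^n`, `τ = 8 / (√ε √(2^n))`). [folklore] -/
theorem digitalBilinearLiouville_of_rectangles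
    (h : ∀ ε : ℝ, 0 < ε → ∃ n₀ : ℕ, ∀ n ≥ n₀, ∀ π : Fin n ⊕ Fin n ≃ Fin (2 * n),
      ∀ A B : Finset (Fin n → Bool),
        |∑ r ∈ A, ∑ c ∈ B, ((liouville
          (Nat.ofBits (fun j : Fin (2 * n) => Sum.elim r c (π.symm j)) + 1) : ℤ) : ℝ)| ≤
          ε * 4 ^ n) :
    DigitalBilinearLiouville := by
  classical
  intro ε hε
  set δ : ℝ := ε * Real.sqrt ε / 1024 with hδ
  have hδpos : 0 < δ := by positivity
  obtain ⟨n₀, hn₀⟩ := h δ hδpos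
  refine ⟨n₀, fun n hn π u w => ?_⟩
  set N : ℝ := (2 : ℝ) ^ n with hN
  have hNpos : 0 < N := by positivity
  set t : ℝ := 8 / Real.sqrt ε with ht
  set τ : ℝ := t / Real.sqrt N with hτ
  have hsε : 0 < Real.sqrt ε := Real.sqrt_pos.mpr hε
  have hsN : 0 < Real.sqrt N := Real.sqrt_pos.mpr hNpos
  have htpos : 0 < t := by positivity
  have hτpos : 0 < τ := by positivity
  have key := norm_sum_mul_mul_sq_le (ι := Fin n → Bool) (κ := Fin n → Bool)
    (fun r c => (((liouville
      (Nat.ofBits (fun j : Fin (2 * n) => Sum.elim r c (π.symm j)) + 1) : ℤ) : ℝ)))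
    (fun r c => abs_liouville_succ_cast_le_one _) (δ * 4 ^ n) (fun A B => hn₀ n hn π A B)
    τ hτpos u w
  have hcard : (Fintype.card (Fin n → Bool) : ℝ) = N := by
    rw [Fintype.card_fun, Fintype.card_bool, Fintype.card_fin]
    push_cast
    rfl
  simp only [Complex.ofReal_intCast, hcard] at key
  refine key.trans ?_
  -- the constant: `K = 4 τ² δ 4^n + 2 √N / τ = (√ε / 2) N`, so `4 K² = ε 4^n`
  have h4 : (4 : ℝ) ^ n = N * N := by rw [hN, ← mul_pow]; norm_num
  have hNN : Real.sqrt N * Real.sqrt N = N := Real.mul_self_sqrt hNpos.le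
  have hτsq : τ ^ 2 = 64 / ε / N := by
    rw [hτ, div_pow, Real.sq_sqrt hNpos.le, ht, div_pow, Real.sq_sqrt hε.le]
    norm_num
  have hpiece1 : τ ^ 2 * (4 * (δ * 4 ^ n)) = Real.sqrt ε / 4 * N := by
    rw [hτsq, h4, hδ]
    field_simp
    ring
  have hpiece2 : (Real.sqrt N + Real.sqrt N) / τ = Real.sqrt ε / 4 * N := by
    rw [hτ, div_div_eq_mul_div, add_mul, hNN, ht, div_div_eq_mul_div]
    field_simp
    ring
  have hK : τ ^ 2 * (4 * (δ * 4 ^ n)) + (Real.sqrt N + Real.sqrt N) / τ = Real.sqrt ε / 2 * N := by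
    rw [hpiece1, hpiece2]
    ring
  have hmain : 4 * (τ ^ 2 * (4 * (δ * 4 ^ n)) + (Real.sqrt N + Real.sqrt N) / τ) ^ 2 =
      ε * 4 ^ n := by
    rw [hK, h4, mul_pow, div_pow, Real.sq_sqrt hε.le]
    ring
  rw [hmain]

/-- ★ **`DigitalBilinearLiouville` ⟺ its rectangle-discrepancy form.**  The crux (operator norm
`o(2^n)` of every balanced digital cut matrix of `λ`, tested against all complex vectors) holds
iff `λ` has discrepancy `o(4^n)` on every digital combinatorial rectangle: for every `ε > 0`,
eventually, for every balanced cut `π` of the `2n` bit positions and all sets `A, B ⊆ {0,1}^n` of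
row / column digit strings, `|Σ_{r ∈ A} Σ_{c ∈ B} λ(N_π(r, c) + 1)| ≤ ε · 4^n`. [folklore] -/
theorem digitalBilinearLiouville_iff_rectangles :
    DigitalBilinearLiouville ↔
      ∀ ε : ℝ, 0 < ε → ∃ n₀ : ℕ, ∀ n ≥ n₀, ∀ π : Fin n ⊕ Fin n ≃ Fin (2 * n),
        ∀ A B : Finset (Fin n → Bool),
          |∑ r ∈ A, ∑ c ∈ B, ((liouville
            (Nat.ofBits (fun j : Fin (2 * n) => Sum.elim r c (π.symm j)) + 1) : ℤ) : ℝ)| ≤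
            ε * 4 ^ n :=
  ⟨rectangles_of_digitalBilinearLiouville, digitalBilinearLiouville_of_rectangles⟩

end Summit.ValiantsHypothesis.ValiantsHypothesis.Theorems.LiouvilleSarnakDigitalBilinearLiouville.Rectangles
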